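import Mathlib.Analysis.Distribution.SchwartzSpace.Basic
import Mathlib.Algebra.Module.ZLattice.Summable
import HarnessLib

/-!
# Lattice sums of Schwartz functions: `∑_{ℓ ∈ L} ‖f(x + ℓ)‖` converges, locally uniformly in `x`

`Literature/Analysis/Distribution` support file (everything proved, no definitions). For a
finite-dimensional real normed space `E`, a discrete subgroup `L ≤ E` (a `ℤ`-submodule with the
discrete topology, e.g. a full lattice) and a Schwartz function `f ∈ 𝓢(E, F)`:

* `SchwartzMap.exists_summable_forall_norm_add_le` (names are relative to this file's namespace
  `Literature.Analysis.Distribution`) — for every radius `R` there is a summable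
  `u : L → ℝ` with `‖f (x + ℓ)‖ ≤ u ℓ` for all `‖x‖ ≤ R` and all `ℓ ∈ L` (**locally uniform summable
  majorants of the lattice translates**);
* `SchwartzMap.summable_norm_add_lattice` — in particular `∑_{ℓ ∈ L} ‖f (x + ℓ)‖ < ∞` for every `x`,
  and `SchwartzMap.summable_norm_lattice` (`x = 0`).

Proof: Schwartz decay `(1 + ‖y‖)^k ‖f y‖ ≤ C` with `k = rank L + 1` (Mathlib
`SchwartzMap.one_add_le_sup_seminorm_apply`), Peetre's inequality
`1 + ‖ℓ‖ ≤ (1 + R)(1 + ‖x + ℓ‖)` for `‖x‖ ≤ R`, and the convergence of `∑_{ℓ ∈ L} ‖ℓ‖^{-k}` for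
`k > rank L` (Mathlib `ZLattice.summable_norm_pow_inv`). These are the hypotheses "summable
majorants of the translates, locally uniformly" and "summable Fourier coefficients" of the Poisson
summation formula (`Literature.NumberTheory.Automorphic.AdeleRing.pi_tsum_eq_inv_measure_mul_tsum_piFourierCoeff`)
for the archimedean component of a Schwartz–Bruhat function; consumer: the Poisson summation on
`M_n(𝔸_K)` in the discharge of `GodementJacquet1972_gjZeta_meromorphic`.

Mathlib has the decay of Schwartz functions and the lattice `p`-series, but no statement combining
them (`lean search 'Schwartz.*attice|lattice.*Schwartz|summable.*SchwartzMap'`: no hits).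

## References

* J. Tate, in Cassels–Fröhlich (1967), Ch. XV, Lemma 4.2.3 (the translates of a nice function sum
  locally uniformly) [folklore].
-/

noncomputable section

open scoped SchwartzMap

namespace Literature.Analysis.Distribution

variable {E F : Type*} [NormedAddCommGroup E] [NormedSpace ℝ E]
  [NormedAddCommGroup F] [NormedSpace ℝ F]

/-- **Schwartz decay with the weight `(1 + ‖y‖)^k`**: `(1 + ‖y‖)^k ‖f y‖ ≤ C` for some `C > 0`
(Mathlib `SchwartzMap.one_add_le_sup_seminorm_apply` with `n = 0`). [folklore] -/
theorem SchwartzMap.exists_one_add_norm_pow_mul_norm_le (f : 𝓢(E, F)) (k : ℕ) :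
    ∃ C : ℝ, 0 < C ∧ ∀ y : E, (1 + ‖y‖) ^ k * ‖f y‖ ≤ C := by
  refine ⟨max (2 ^ k * (Finset.Iic (k, 0)).sup (fun m => SchwartzMap.seminorm ℝ m.1 m.2) f) 1,
    by positivity, fun y => ?_⟩
  have h := SchwartzMap.one_add_le_sup_seminorm_apply (𝕜 := ℝ) (m := (k, 0)) (k := k) (n := 0)
    le_rfl le_rfl f y
  rw [norm_iteratedFDeriv_zero] at h
  exact h.trans (le_max_left _ _)

omit [NormedSpace ℝ E] in
/-- Peetre's inequality in the form used here: for `‖x‖ ≤ R`, `1 + ‖ℓ‖ ≤ (1 + R) (1 + ‖x + ℓ‖)`.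
[folklore] -/
theorem one_add_norm_le_mul_one_add_norm_add {x ℓ : E} {R : ℝ} (hx : ‖x‖ ≤ R) :
    1 + ‖ℓ‖ ≤ (1 + R) * (1 + ‖x + ℓ‖) := by
  have hR : 0 ≤ R := (norm_nonneg x).trans hx
  have h1 : ‖ℓ‖ ≤ ‖x + ℓ‖ + ‖x‖ := by
    calc ‖ℓ‖ = ‖(x + ℓ) - x‖ := by rw [add_sub_cancel_left]
      _ ≤ ‖x + ℓ‖ + ‖x‖ := norm_sub_le _ _
  nlinarith [norm_nonneg (x + ℓ), norm_nonneg x]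

/-- **Locally uniform summable majorants of the lattice translates of a Schwartz function.** For a
discrete subgroup `L` of a finite-dimensional real normed space, `f ∈ 𝓢(E, F)` and any real `R`,
there is a summable `u : L → ℝ` with `‖f (x + ℓ)‖ ≤ u ℓ` whenever `‖x‖ ≤ R`
(Tate's Lemma 4.2.3 hypothesis for the archimedean factor of a Schwartz–Bruhat function).
Proof: `‖f(x + ℓ)‖ ≤ C (1 + ‖x + ℓ‖)^{-k} ≤ C (1 + R)^k (1 + ‖ℓ‖)^{-k}` with `k = rank L + 1`, and
`∑_ℓ (1 + ‖ℓ‖)^{-k} ≤ 1 + ∑_ℓ ‖ℓ‖^{-k} < ∞` (`ZLattice.summable_norm_pow_inv`). [folklore] -/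
theorem SchwartzMap.exists_summable_forall_norm_add_le [FiniteDimensional ℝ E]
    (L : Submodule ℤ E) [DiscreteTopology L] (f : 𝓢(E, F)) (R : ℝ) :
    ∃ u : L → ℝ, Summable u ∧ ∀ x : E, ‖x‖ ≤ R → ∀ ℓ : L, ‖f (x + (ℓ : E))‖ ≤ u ℓ := by
  set k : ℕ := Module.finrank ℤ L + 1 with hk
  obtain ⟨C, hC, hf⟩ := SchwartzMap.exists_one_add_norm_pow_mul_norm_le f k
  rcases lt_or_ge R 0 with hR | hR
  · -- no `x` with `‖x‖ ≤ R < 0`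
    exact ⟨0, summable_zero, fun x hx => absurd (hx.trans_lt hR) (not_lt.2 (norm_nonneg x))⟩
  refine ⟨fun ℓ => C * (1 + R) ^ k * ((1 + ‖(ℓ : E)‖) ^ k)⁻¹, ?_, fun x hx ℓ => ?_⟩
  · -- summability: compare with `‖ℓ‖⁻¹ ^ k` off `ℓ = 0`
    refine Summable.mul_left _ ?_
    have hs := ZLattice.summable_norm_pow_inv L k (by rw [hk]; exact Nat.lt_succ_self _)
    refine hs.of_norm_bounded_eventually (Filter.eventually_cofinite.2
      ((Set.finite_singleton (0 : L)).subset fun ℓ hℓ => ?_))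
    by_contra h0
    refine hℓ ?_
    have hpos : 0 < ‖(ℓ : E)‖ := norm_pos_iff.2 (by simpa using h0)
    rw [Real.norm_of_nonneg (by positivity)]
    change ((1 + ‖(ℓ : E)‖) ^ k)⁻¹ ≤ ‖(ℓ : E)‖⁻¹ ^ k
    rw [inv_pow]
    exact inv_anti₀ (pow_pos hpos k) (pow_le_pow_left₀ hpos.le (by linarith) k)
  · -- the bound
    have hden : 0 < (1 + ‖x + (ℓ : E)‖) ^ k := by positivity
    have hfy := hf (x + (ℓ : E))
    have h1 : ‖f (x + (ℓ : E))‖ ≤ C * ((1 + ‖x + (ℓ : E)‖) ^ k)⁻¹ := by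
      rw [← div_eq_mul_inv, le_div_iff₀ hden, mul_comm]
      exact hfy
    refine h1.trans ?_
    have hP : (1 + ‖(ℓ : E)‖) ^ k ≤ (1 + R) ^ k * (1 + ‖x + (ℓ : E)‖) ^ k := by
      rw [← mul_pow]
      exact pow_le_pow_left₀ (by positivity) (one_add_norm_le_mul_one_add_norm_add hx) k
    have hℓpos : 0 < (1 + ‖(ℓ : E)‖) ^ k := by positivity
    calc C * ((1 + ‖x + (ℓ : E)‖) ^ k)⁻¹
        = C * (1 + R) ^ k * (((1 + R) ^ k * (1 + ‖x + (ℓ : E)‖) ^ k))⁻¹ := by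
          have hRk : (1 + R) ^ k ≠ 0 := by positivity
          field_simp
      _ ≤ C * (1 + R) ^ k * ((1 + ‖(ℓ : E)‖) ^ k)⁻¹ := by
          refine mul_le_mul_of_nonneg_left (inv_anti₀ hℓpos hP) (by positivity)

/-- **`∑_{ℓ ∈ L} ‖f (x + ℓ)‖ < ∞`** for a Schwartz function and a discrete subgroup. [folklore] -/
theorem SchwartzMap.summable_norm_add_lattice [FiniteDimensional ℝ E]
    (L : Submodule ℤ E) [DiscreteTopology L] (f : 𝓢(E, F)) (x : E) :
    Summable fun ℓ : L => ‖f (x + (ℓ : E))‖ := by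
  obtain ⟨u, hu, hb⟩ := SchwartzMap.exists_summable_forall_norm_add_le L f ‖x‖
  exact Summable.of_nonneg_of_le (fun _ => norm_nonneg _) (fun ℓ => hb x le_rfl ℓ) hu

/-- **`∑_{ℓ ∈ L} ‖f ℓ‖ < ∞`** for a Schwartz function and a discrete subgroup. [folklore] -/
theorem SchwartzMap.summable_norm_lattice [FiniteDimensional ℝ E]
    (L : Submodule ℤ E) [DiscreteTopology L] (f : 𝓢(E, F)) :
    Summable fun ℓ : L => ‖f (ℓ : E)‖ := by
  simpa using SchwartzMap.summable_norm_add_lattice L f 0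

end Literature.Analysis.Distribution
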